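import Mathlib

/-!
# The real-place term of THEOREM ★ (§7.11 (16.11)(g)), certified in the cases used

In the Greenberg–Wiles count `dim U_k(η) = dim Sel*_k(η) − 3⌊k/2⌋ − 2` (THEOREM ★ of the
residency paper, Part II §7.11 (16.11)(g)) each of the three real places of the cubic field
contributes `h⁰(ℝ, Fil_k) = ⌊k/2⌋ + 1`: complex conjugation acts on the affine line by the
reflection `t ↦ κ − t` (`κ = κ_η(c_v)`), and the invariant polynomials of degree `≤ k` are the
polynomials in `(t − κ/2)²`.  This file certifies that count, by exhaustive kernel computation,
in exactly the cases the paper uses: `p = 5`, `k = 1, 2` (packages and conics, THEOREMS E, E′)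
and `p = 7`, `k = 1, 2, 3` (packages, THEOREM E(7,2), the cubic count law): for every `κ` the
reflection `f(t) ↦ f(κ − t)` on coefficient vectors of polynomials of degree `≤ k` over `𝔽_p`
has exactly `p^(⌊k/2⌋+1)` fixed vectors.  The maps below are `f(κ − t)` expanded in the monomial
basis (degree `≤ 1, 2, 3`).  Informal citation: solo-Langlands-informed, CLAIMS c190 (THEOREM ★),
c204 (THEOREM E(7,2)).
-/

namespace Summit.Langlands.Langlands.Theorems

/-- `f(t) = c₀ + c₁ t ↦ f(κ − t)`. -/
def soloReflect1 {p : ℕ} (κ : ZMod p) (c : ZMod p × ZMod p) : ZMod p × ZMod p :=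
  (c.1 + c.2 * κ, -c.2)

/-- `f(t) = c₀ + c₁ t + c₂ t² ↦ f(κ − t)`. -/
def soloReflect2 {p : ℕ} (κ : ZMod p) (c : ZMod p × ZMod p × ZMod p) : ZMod p × ZMod p × ZMod p :=
  (c.1 + c.2.1 * κ + c.2.2 * κ ^ 2, -(c.2.1 + 2 * c.2.2 * κ), c.2.2)

/-- `f(t) = c₀ + c₁ t + c₂ t² + c₃ t³ ↦ f(κ − t)`. -/
def soloReflect3 {p : ℕ} (κ : ZMod p) (c : ZMod p × ZMod p × ZMod p × ZMod p) :
    ZMod p × ZMod p × ZMod p × ZMod p :=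
  (c.1 + c.2.1 * κ + c.2.2.1 * κ ^ 2 + c.2.2.2 * κ ^ 3,
   -(c.2.1 + 2 * c.2.2.1 * κ + 3 * c.2.2.2 * κ ^ 2),
   c.2.2.1 + 3 * c.2.2.2 * κ,
   -c.2.2.2)

/-- The expansions are involutions (sanity check that they are the reflection): `p = 7`, `k = 3`. -/
theorem soloInformed_reflect3_involutive_seven (κ : ZMod 7) (c : ZMod 7 × ZMod 7 × ZMod 7 × ZMod 7) :
    soloReflect3 κ (soloReflect3 κ c) = c := by
  obtain ⟨c0, c1, c2, c3⟩ := c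
  simp only [soloReflect3, Prod.mk.injEq]
  refine ⟨by ring, by ring, by ring, by ring⟩

/-- `p = 5`, `k = 1`: `5 = 5^(⌊1/2⌋+1)` invariant vectors for every `κ`. -/
theorem soloInformed_realPlace_five_deg1 (κ : ZMod 5) :
    (Finset.univ.filter (fun c : ZMod 5 × ZMod 5 => soloReflect1 κ c = c)).card = 5 := by
  revert κ; decide

/-- `p = 5`, `k = 2`: `25 = 5^(⌊2/2⌋+1)` invariant vectors for every `κ`. -/
theorem soloInformed_realPlace_five_deg2 (κ : ZMod 5) :
    (Finset.univ.filter (fun c : ZMod 5 × ZMod 5 × ZMod 5 => soloReflect2 κ c = c)).card = 25 := by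
  revert κ; decide

/-- `p = 7`, `k = 1`: `7` invariant vectors for every `κ`. -/
theorem soloInformed_realPlace_seven_deg1 (κ : ZMod 7) :
    (Finset.univ.filter (fun c : ZMod 7 × ZMod 7 => soloReflect1 κ c = c)).card = 7 := by
  revert κ; decide

/-- `p = 7`, `k = 2`: `49 = 7^(⌊2/2⌋+1)` invariant vectors for every `κ`. -/
theorem soloInformed_realPlace_seven_deg2 (κ : ZMod 7) :
    (Finset.univ.filter (fun c : ZMod 7 × ZMod 7 × ZMod 7 => soloReflect2 κ c = c)).card = 49 := by
  revert κ; decide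

set_option maxRecDepth 100000 in
/-- `p = 7`, `k = 3`: `49 = 7^(⌊3/2⌋+1)` invariant vectors for every `κ` (the cubic count law). -/
theorem soloInformed_realPlace_seven_deg3 (κ : ZMod 7) :
    (Finset.univ.filter
      (fun c : ZMod 7 × ZMod 7 × ZMod 7 × ZMod 7 => soloReflect3 κ c = c)).card = 49 := by
  revert κ; decide

end Summit.Langlands.Langlands.Theorems
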